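import Literature.NumberTheory.Automorphic.ModularLambdaCovering
import Literature.NumberTheory.ModularForms.LogLambda
import HarnessLib

/-!
# The uniformizer `x = (λ/16)^{1/N}` of Calegari–Dimitrov–Tang and the covering `ℍ → ℂ^× ∖ 16^{-1/N}μ_N`

F. Calegari, V. Dimitrov, Y. Tang, *The unbounded denominators conjecture*, J. Amer. Math. Soc.
**38** (2025), 627–702 (arXiv:2109.09040), proof of Proposition 15 (§3): "Let `t := q^{1/N}`. We
use Theorem (holonomy) with `U := ℂ ∖ 16^{-1/N} μ_N`, `p(x) := x^N` and
`x := (λ(τ)/16)^{1/N} ∈ t + t² ℤ[1/N]⟦t⟧` … the pullback of `L` to `U ∖ {0} = ℂ^× ∖ 16^{-1/N}μ_N`".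
As a function on `ℍ`, `x = (λ/16)^{1/N}` is the holomorphic `N`-th root of `λ/16` normalised by
`x · e^{−πiτ/N} → 1` at `i∞`; it is the covering map of `U ∖ {0}` by `ℍ` through which every
analytic map from a simply connected domain to `U ∖ {0}` factors. This file DEFINES it and PROVES
the covering property, on top of `ModularLambdaCovering.lean` (`λ : ℍ → ℂ ∖ {0,1}` is the quotient
covering of the free part `Λ = ⟨T², ST²S⁻¹⟩` of `Γ(2)`) and of the holomorphic logarithm
`𝓛 = log λ` of `Literature/NumberTheory/ModularForms/LogLambda.lean`:

* `modularLambdaRoot N τ = exp((𝓛(τ) − log 16)/N)` — **the uniformizer `x = (λ/16)^{1/N}`**;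
  `modularLambdaRoot_pow` (`x^N = λ/16`), `modularLambdaRoot_ne_zero`,
  `sixteen_mul_modularLambdaRoot_pow_ne_one` (`x ∈ U ∖ {0}`), `continuous_modularLambdaRoot`,
  `tendsto_modularLambdaRoot_mul_exp` (`x · e^{−πiτ/N} → 1`, i.e. `x = t + O(t²)`, `t = e^{πiτ/N}`);
* `modularLambdaRoot_T_sq_smul` (`x(τ + 2) = e^{2πi/N} x(τ)`), `modularLambdaRoot_conj_smul`
  (`x(ST²S⁻¹ τ) = x(τ)`), `exists_modularLambdaRoot_smul_eq` (on `Λ`, `x ∘ γ = ζ^k x`);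
* `modularLambdaRootDeck N` — **the deck group** `Λ_N = {γ ∈ Λ | x ∘ γ = x}` (a non-congruence
  subgroup in general: the Fermat groups), `T_pow_mem_modularLambdaRootDeck` (`T^{2N} ∈ Λ_N`),
  `modularLambdaRoot_eq_modularLambdaRoot_iff` (**the fibres of `x` are the `Λ_N`-orbits**);
* **`isQuotientCoveringMap_modularLambdaRoot`, `isCoveringMap_modularLambdaRoot`,
  `isCoveringMapOn_modularLambdaRoot`** — `x : ℍ → ℂ^× ∖ 16^{-1/N}μ_N` is the quotient covering
  map of the free, properly discontinuous action of `Λ_N`, and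
  `exists_unique_lift_modularLambdaRoot` (lifting of continuous maps from simply connected
  spaces).

## References

* [CalegariDimitrovTang2025] arXiv:2109.09040, §3, proof of Proposition 15 (the uniformizer
  `x = (λ/16)^{1/N}`, `U ∖ {0} = ℂ^× ∖ 16^{-1/N} μ_N`); §1.1.2 p. 5–6.
-/

noncomputable section

open Complex Filter Topology UpperHalfPlane ModularGroup Matrix.SpecialLinearGroup

open scoped MatrixGroups ModularForm Real Manifold

namespace Literature.NumberTheory.Automorphic

namespace ModularLambda

open Literature.NumberTheory.ModularForms (logLambda logLambdaS cexp_logLambda continuous_logLambda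
  logLambda_vadd_one logLambdaS_vadd_one logLambda_S_smul logLambdaS_S_smul
  tendsto_logLambda_sub_atImInfty mdifferentiable_logLambda)

/-! ## The uniformizer `x = (λ/16)^{1/N}` -/

/-- **The uniformizer `x = (λ/16)^{1/N}`** of Calegari–Dimitrov–Tang: the holomorphic `N`-th root
of `λ/16` on `ℍ` with `x e^{−πiτ/N} → 1` at `i∞`, `x(τ) = exp((𝓛(τ) − log 16)/N)` for the
normalised logarithm `𝓛` of `λ`. [cite: CalegariDimitrovTang2025, §3, proof of Proposition 15] -/
def modularLambdaRoot (N : ℕ) (τ : ℍ) : ℂ :=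
  Complex.exp ((logLambda τ - (Real.log 16 : ℝ)) / N)

/-- Unfolding lemma for `modularLambdaRoot`. [folklore] -/
theorem modularLambdaRoot_def (N : ℕ) (τ : ℍ) :
    modularLambdaRoot N τ = Complex.exp ((logLambda τ - (Real.log 16 : ℝ)) / N) := rfl

/-- `x ≠ 0`. [folklore] -/
theorem modularLambdaRoot_ne_zero (N : ℕ) (τ : ℍ) : modularLambdaRoot N τ ≠ 0 :=
  Complex.exp_ne_zero _

/-- **`x^N = λ/16`.** [cite: CalegariDimitrovTang2025, §3, proof of Proposition 15] -/
theorem modularLambdaRoot_pow {N : ℕ} (hN : N ≠ 0) (τ : ℍ) :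
    modularLambdaRoot N τ ^ N = modularLambda (τ : ℂ) / 16 := by
  rw [modularLambdaRoot, ← Complex.exp_nat_mul, mul_div_cancel₀ _ (by exact_mod_cast hN),
    Complex.exp_sub, cexp_logLambda, modularForms_modularLambda_eq, Complex.ofReal_log (by norm_num),
    Complex.exp_log (by norm_num)]
  norm_num

/-- `16 x^N = λ ≠ 1`: `x` takes values in `U ∖ {0} = ℂ^× ∖ 16^{-1/N} μ_N`.
[cite: CalegariDimitrovTang2025, §3, proof of Proposition 15] -/
theorem sixteen_mul_modularLambdaRoot_pow_ne_one {N : ℕ} (hN : N ≠ 0) (τ : ℍ) :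
    16 * modularLambdaRoot N τ ^ N ≠ 1 := by
  rw [modularLambdaRoot_pow hN, mul_div_cancel₀ _ (by norm_num : (16 : ℂ) ≠ 0)]
  exact modularLambda_ne_one τ.2

/-- `x` is continuous on `ℍ`. [folklore] -/
theorem continuous_modularLambdaRoot (N : ℕ) : Continuous (modularLambdaRoot N) :=
  Complex.continuous_exp.comp ((continuous_logLambda.sub continuous_const).div_const _)

/-- `x` is holomorphic: `x ∘ ofComplex` is complex-differentiable on the upper half-plane.
[folklore] -/
theorem differentiableOn_modularLambdaRoot_comp_ofComplex (N : ℕ) :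
    DifferentiableOn ℂ (modularLambdaRoot N ∘ ofComplex) {w : ℂ | 0 < w.im} := by
  have h : DifferentiableOn ℂ (logLambda ∘ ofComplex) {w : ℂ | 0 < w.im} :=
    UpperHalfPlane.mdifferentiable_iff.mp mdifferentiable_logLambda
  exact ((h.sub_const _).div_const _).cexp

/-- `x` is holomorphic on `ℍ`. [folklore] -/
theorem mdifferentiable_modularLambdaRoot (N : ℕ) : MDiff (modularLambdaRoot N) :=
  UpperHalfPlane.mdifferentiable_iff.mpr (differentiableOn_modularLambdaRoot_comp_ofComplex N)

/-- **`x e^{−πiτ/N} → 1` at `i∞`** (`x = t + O(t²)` in `t = e^{πiτ/N}`).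
[cite: CalegariDimitrovTang2025, §3, proof of Proposition 15] -/
theorem tendsto_modularLambdaRoot_mul_exp {N : ℕ} (hN : N ≠ 0) :
    Tendsto (fun τ : ℍ ↦ modularLambdaRoot N τ * Complex.exp (-(π * Complex.I * τ / N)))
      atImInfty (𝓝 1) := by
  have hN' : (N : ℂ) ≠ 0 := by exact_mod_cast hN
  have h := ((tendsto_logLambda_sub_atImInfty.sub_const ((Real.log 16 : ℝ) : ℂ)).div_const
    (N : ℂ)).cexp
  rw [sub_self, zero_div, Complex.exp_zero] at h
  refine h.congr fun τ ↦ ?_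
  rw [modularLambdaRoot, ← Complex.exp_add]
  congr 1
  ring

/-! ## Transformation under `Λ = ⟨T², S T² S⁻¹⟩` -/

/-- `𝓛(τ + 2) = 𝓛(τ) + 2πi`. [folklore] -/
theorem logLambda_T_sq_smul (τ : ℍ) :
    logLambda ((T ^ 2 : SL(2, ℤ)) • τ) = logLambda τ + 2 * π * Complex.I := by
  rw [pow_two, mul_smul, modular_T_smul, modular_T_smul, logLambda_vadd_one, logLambda_vadd_one,
    logLambdaS_vadd_one]
  ring

/-- `𝓛(S T² S⁻¹ τ) = 𝓛(τ)`. [folklore] -/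
theorem logLambda_S_T_sq_S_inv_smul (τ : ℍ) :
    logLambda ((S * T ^ 2 * S⁻¹ : SL(2, ℤ)) • τ) = logLambda τ := by
  have hS2 : ∀ σ : ℍ, logLambdaS ((T ^ 2 : SL(2, ℤ)) • σ) = logLambdaS σ := fun σ ↦ by
    rw [pow_two, mul_smul, modular_T_smul, modular_T_smul, logLambdaS_vadd_one,
      logLambdaS_vadd_one, neg_neg]
  rw [mul_smul, mul_smul, logLambda_S_smul, hS2, ModularGroup.S_inv, SL_neg_smul, logLambdaS_S_smul]

/-- **`x(τ + 2) = e^{2πi/N} x(τ)`.** [cite: CalegariDimitrovTang2025, §3, proof of Proposition 15] -/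
theorem modularLambdaRoot_T_sq_smul {N : ℕ} (hN : N ≠ 0) (τ : ℍ) :
    modularLambdaRoot N ((T ^ 2 : SL(2, ℤ)) • τ) =
      Complex.exp (2 * π * Complex.I / N) * modularLambdaRoot N τ := by
  rw [modularLambdaRoot, modularLambdaRoot, logLambda_T_sq_smul, ← Complex.exp_add]
  congr 1
  have hN' : (N : ℂ) ≠ 0 := by exact_mod_cast hN
  field_simp
  ring

/-- `x(S T² S⁻¹ τ) = x(τ)`. [folklore] -/
theorem modularLambdaRoot_S_T_sq_S_inv_smul (N : ℕ) (τ : ℍ) :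
    modularLambdaRoot N ((S * T ^ 2 * S⁻¹ : SL(2, ℤ)) • τ) = modularLambdaRoot N τ := by
  rw [modularLambdaRoot, modularLambdaRoot, logLambda_S_T_sq_S_inv_smul]

/-- `x((T²)ⁿ τ) = e^{2πin/N} x(τ)`. [folklore] -/
theorem modularLambdaRoot_T_sq_pow_smul {N : ℕ} (hN : N ≠ 0) (n : ℕ) (τ : ℍ) :
    modularLambdaRoot N (((T ^ 2) ^ n : SL(2, ℤ)) • τ) =
      Complex.exp (2 * π * Complex.I / N) ^ n * modularLambdaRoot N τ := by
  induction n with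
  | zero => simp
  | succ n ih => rw [pow_succ', mul_smul, modularLambdaRoot_T_sq_smul hN, ih, pow_succ]; ring

/-- `e^{2πi/N}` is an `N`-th root of unity. [folklore] -/
theorem exp_two_pi_I_div_pow (N : ℕ) : Complex.exp (2 * π * Complex.I / N) ^ N = 1 := by
  rcases Nat.eq_zero_or_pos N with rfl | hN
  · simp
  · exact (Complex.isPrimitiveRoot_exp N hN.ne').pow_eq_one

/-- **On `Λ`, `x ∘ γ = ζ^k x`** with `ζ = e^{2πi/N}` (`x^N = λ/16` is `Λ`-invariant).
[cite: CalegariDimitrovTang2025, §3, proof of Proposition 15] -/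
theorem exists_modularLambdaRoot_smul_eq {N : ℕ} (hN : N ≠ 0) {γ : SL(2, ℤ)}
    (hγ : γ ∈ Subgroup.closure ({T ^ 2, S * T ^ 2 * S⁻¹} : Set SL(2, ℤ))) :
    ∃ k : ℕ, ∀ τ : ℍ, modularLambdaRoot N (γ • τ) =
      Complex.exp (2 * π * Complex.I / N) ^ k * modularLambdaRoot N τ := by
  induction hγ using Subgroup.closure_induction with
  | mem x hx =>
    rcases hx with rfl | rfl
    · exact ⟨1, fun τ ↦ by rw [pow_one, modularLambdaRoot_T_sq_smul hN]⟩
    · exact ⟨0, fun τ ↦ by rw [pow_zero, one_mul, modularLambdaRoot_S_T_sq_S_inv_smul]⟩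
  | one => exact ⟨0, fun τ ↦ by rw [pow_zero, one_mul, one_smul]⟩
  | mul x y _ _ hx hy =>
    obtain ⟨k, hk⟩ := hx
    obtain ⟨k', hk'⟩ := hy
    exact ⟨k + k', fun τ ↦ by rw [mul_smul, hk, hk', pow_add]; ring⟩
  | inv x _ hx =>
    obtain ⟨k, hk⟩ := hx
    refine ⟨(N - 1) * k, fun τ ↦ ?_⟩
    have h := hk (x⁻¹ • τ)
    rw [smul_inv_smul] at h
    have hζ := exp_two_pi_I_div_pow N
    have hζ0 : Complex.exp (2 * π * Complex.I / N) ≠ 0 := Complex.exp_ne_zero _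
    -- `ζ^k ζ^{(N-1)k} = ζ^{Nk} = 1`
    have hinv : Complex.exp (2 * π * Complex.I / N) ^ k *
        Complex.exp (2 * π * Complex.I / N) ^ ((N - 1) * k) = 1 := by
      rw [← pow_add, show k + (N - 1) * k = N * k by
        rcases Nat.exists_eq_succ_of_ne_zero hN with ⟨n, rfl⟩; simp; ring,
        pow_mul, hζ, one_pow]
    calc modularLambdaRoot N (x⁻¹ • τ)
        = (Complex.exp (2 * π * Complex.I / N) ^ k *
            Complex.exp (2 * π * Complex.I / N) ^ ((N - 1) * k)) * modularLambdaRoot N (x⁻¹ • τ) := by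
          rw [hinv, one_mul]
      _ = Complex.exp (2 * π * Complex.I / N) ^ ((N - 1) * k) * modularLambdaRoot N τ := by
          rw [h]; ring

/-! ## The deck group `Λ_N` -/

/-- **The deck group `Λ_N = {γ ∈ Λ | x ∘ γ = x}`** of the uniformizer `x = (λ/16)^{1/N}`
(`Λ = ⟨T², S T² S⁻¹⟩` the free part of `Γ(2)`); for `N ∉ {1, 2, 4, 8}` a non-congruence subgroup
(the groups of the Fermat curves). [cite: CalegariDimitrovTang2025, §3, proof of Proposition 15] -/
def modularLambdaRootDeck (N : ℕ) : Subgroup SL(2, ℤ) where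
  carrier := {γ | γ ∈ Subgroup.closure ({T ^ 2, S * T ^ 2 * S⁻¹} : Set SL(2, ℤ)) ∧
    ∀ τ : ℍ, modularLambdaRoot N (γ • τ) = modularLambdaRoot N τ}
  mul_mem' := by
    rintro a b ⟨ha, ha'⟩ ⟨hb, hb'⟩
    exact ⟨mul_mem ha hb, fun τ ↦ by rw [mul_smul, ha', hb']⟩
  one_mem' := ⟨one_mem _, fun τ ↦ by rw [one_smul]⟩
  inv_mem' := by
    rintro a ⟨ha, ha'⟩
    exact ⟨inv_mem ha, fun τ ↦ by rw [← ha' (a⁻¹ • τ), smul_inv_smul]⟩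

/-- Membership in the deck group `Λ_N`. [folklore] -/
theorem mem_modularLambdaRootDeck_iff {N : ℕ} {γ : SL(2, ℤ)} :
    γ ∈ modularLambdaRootDeck N ↔
      γ ∈ Subgroup.closure ({T ^ 2, S * T ^ 2 * S⁻¹} : Set SL(2, ℤ)) ∧
        ∀ τ : ℍ, modularLambdaRoot N (γ • τ) = modularLambdaRoot N τ :=
  Iff.rfl

/-- `Λ_N ≤ Λ`. [folklore] -/
theorem modularLambdaRootDeck_le_closure (N : ℕ) :
    modularLambdaRootDeck N ≤ Subgroup.closure ({T ^ 2, S * T ^ 2 * S⁻¹} : Set SL(2, ℤ)) :=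
  fun _ h ↦ h.1

/-- `Λ_N ≤ Γ(2)`. [folklore] -/
theorem modularLambdaRootDeck_le_Gamma_two (N : ℕ) :
    modularLambdaRootDeck N ≤ CongruenceSubgroup.Gamma 2 :=
  (modularLambdaRootDeck_le_closure N).trans closure_T_sq_le_Gamma_two

/-- `S T² S⁻¹ ∈ Λ_N`. [folklore] -/
theorem S_mul_T_sq_mul_S_inv_mem_modularLambdaRootDeck (N : ℕ) :
    (S * T ^ 2 * S⁻¹ : SL(2, ℤ)) ∈ modularLambdaRootDeck N :=
  ⟨Subgroup.subset_closure (by simp), modularLambdaRoot_S_T_sq_S_inv_smul N⟩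

/-- **`T^{2N} ∈ Λ_N`**: the cusp `i∞` of `Λ_N` has width `2N`.
[cite: CalegariDimitrovTang2025, §3, proof of Proposition 15] -/
theorem T_pow_two_mul_mem_modularLambdaRootDeck (N : ℕ) :
    (T ^ (2 * N) : SL(2, ℤ)) ∈ modularLambdaRootDeck N := by
  rcases Nat.eq_zero_or_pos N with rfl | hN
  · rw [mul_zero, pow_zero]; exact one_mem _
  refine ⟨by rw [pow_mul]; exact pow_mem (Subgroup.subset_closure (by simp)) N, fun τ ↦ ?_⟩
  rw [pow_mul, modularLambdaRoot_T_sq_pow_smul hN.ne', exp_two_pi_I_div_pow, one_mul]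

/-- **The fibres of `x = (λ/16)^{1/N}` are the `Λ_N`-orbits.**
[cite: CalegariDimitrovTang2025, §3, proof of Proposition 15] -/
theorem modularLambdaRoot_eq_modularLambdaRoot_iff {N : ℕ} (hN : N ≠ 0) {τ₁ τ₂ : ℍ} :
    modularLambdaRoot N τ₁ = modularLambdaRoot N τ₂ ↔ ∃ γ ∈ modularLambdaRootDeck N, γ • τ₁ = τ₂ := by
  constructor
  · intro h
    have hl : modularLambda (τ₂ : ℂ) = modularLambda (τ₁ : ℂ) := by
      have h1 := modularLambdaRoot_pow hN τ₁
      have h2 := modularLambdaRoot_pow hN τ₂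
      rw [h] at h1
      linear_combination 16 * h1 - 16 * h2
    obtain ⟨w, hw⟩ := MulAction.mem_orbit_iff.mp (modularLambda_eq_iff_mem_orbit_closure_T_sq.mp hl)
    -- `w • τ₁ = τ₂` with `w ∈ Λ`; then `x ∘ w = ζ^k x` with `ζ^k = 1`
    obtain ⟨k, hk⟩ := exists_modularLambdaRoot_smul_eq hN w.2
    have hk1 : Complex.exp (2 * π * Complex.I / N) ^ k = 1 := by
      have := hk τ₁
      rw [Subgroup.smul_def] at hw
      rw [hw, ← h] at this
      exact (mul_eq_right₀ (modularLambdaRoot_ne_zero N τ₁)).mp this.symm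
    refine ⟨w, ⟨w.2, fun τ ↦ by rw [hk, hk1, one_mul]⟩, ?_⟩
    rw [Subgroup.smul_def] at hw
    exact hw
  · rintro ⟨γ, hγ, rfl⟩
    exact (hγ.2 τ₁).symm

/-- The fibres of `x` as `Λ_N`-orbits. [folklore] -/
theorem modularLambdaRoot_eq_iff_mem_orbit {N : ℕ} (hN : N ≠ 0) {τ₁ τ₂ : ℍ} :
    modularLambdaRoot N τ₁ = modularLambdaRoot N τ₂ ↔
      τ₁ ∈ MulAction.orbit (modularLambdaRootDeck N) τ₂ := by
  rw [eq_comm, modularLambdaRoot_eq_modularLambdaRoot_iff hN]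
  constructor
  · rintro ⟨γ, hγ, rfl⟩
    exact MulAction.mem_orbit_iff.mpr ⟨⟨γ, hγ⟩, rfl⟩
  · intro h
    obtain ⟨γ, rfl⟩ := MulAction.mem_orbit_iff.mp h
    exact ⟨γ, γ.2, rfl⟩

/-! ## `x : ℍ → ℂ^× ∖ 16^{-1/N} μ_N` is a covering map -/

/-- `x` is an open map (open mapping theorem; `x^N = λ/16` is not constant). [folklore] -/
theorem isOpenMap_modularLambdaRoot {N : ℕ} (hN : N ≠ 0) : IsOpenMap (modularLambdaRoot N) := by
  have hU : IsOpen {w : ℂ | 0 < w.im} := isOpen_lt continuous_const Complex.continuous_im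
  have han : AnalyticOnNhd ℂ (modularLambdaRoot N ∘ ofComplex) {w : ℂ | 0 < w.im} :=
    (differentiableOn_modularLambdaRoot_comp_ofComplex N).analyticOnNhd hU
  rcases han.is_constant_or_isOpen (convex_halfSpace_im_gt 0).isPreconnected with ⟨w, hw⟩ | hopen
  · exfalso
    have h1 := hw _ UpperHalfPlane.I.2
    have h2 := hw _ (T • UpperHalfPlane.I).2
    simp only [Function.comp_apply, ofComplex_apply] at h1 h2
    have h1' := modularLambdaRoot_pow hN UpperHalfPlane.I
    have h2' := modularLambdaRoot_pow hN (T • UpperHalfPlane.I)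
    rw [h1] at h1'
    rw [h2, h1', modularLambda_T_smul, show ((UpperHalfPlane.I : ℍ) : ℂ) = Complex.I from rfl,
      modularLambda_I] at h2'
    norm_num at h2'
  · intro s hs
    have : modularLambdaRoot N '' s =
        (modularLambdaRoot N ∘ ofComplex) '' (((↑) : ℍ → ℂ) '' s) := by
      rw [Set.image_image]
      simp only [Function.comp_apply, ofComplex_apply]
    rw [this]
    exact hopen _ (by rintro _ ⟨z, -, rfl⟩; exact z.2) (isOpenEmbedding_coe.isOpenMap s hs)

/-- `Λ_N` acts freely on `ℍ`. [folklore] -/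
theorem isCancelSMul_modularLambdaRootDeck (N : ℕ) : IsCancelSMul (modularLambdaRootDeck N) ℍ :=
  isCancelSMul_iff_eq_one_of_smul_eq.mpr fun γ _ h ↦
    Subtype.ext (eq_one_of_mem_closure_T_sq_of_smul_eq γ.2.1 h)

/-- **`x(ℍ) = ℂ^× ∖ 16^{-1/N}μ_N`**: every `u ≠ 0` with `16 uᴺ ≠ 1` is a value of `x`.
[cite: CalegariDimitrovTang2025, §3, proof of Proposition 15] -/
theorem exists_modularLambdaRoot_eq {N : ℕ} (hN : N ≠ 0) {u : ℂ} (hu₀ : u ≠ 0)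
    (hu₁ : 16 * u ^ N ≠ 1) : ∃ τ : ℍ, modularLambdaRoot N τ = u := by
  obtain ⟨σ, hσ, hσu⟩ := exists_modularLambda_eq (w := 16 * u ^ N)
    (mul_ne_zero (by norm_num) (pow_ne_zero _ hu₀)) hu₁
  set τ₀ : ℍ := ⟨σ, hσ⟩
  have hpow : (modularLambdaRoot N τ₀ / u) ^ N = 1 := by
    rw [div_pow, modularLambdaRoot_pow hN, show ((τ₀ : ℍ) : ℂ) = σ from rfl, hσu]
    field_simp
  haveI : NeZero N := ⟨hN⟩
  obtain ⟨j, -, hj⟩ := (Complex.isPrimitiveRoot_exp N hN).eq_pow_of_pow_eq_one hpow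
  -- `x(τ₀) = ζ^j u`; translate by `(T²)^{(N-1) j}` to remove `ζ^j`
  refine ⟨((T ^ 2) ^ ((N - 1) * j) : SL(2, ℤ)) • τ₀, ?_⟩
  rw [modularLambdaRoot_T_sq_pow_smul hN]
  have hx : modularLambdaRoot N τ₀ = Complex.exp (2 * π * Complex.I / N) ^ j * u := by
    rw [hj, div_mul_cancel₀ _ hu₀]
  rw [hx, ← mul_assoc, ← pow_add, show (N - 1) * j + j = N * j by
    rcases Nat.exists_eq_succ_of_ne_zero hN with ⟨n, rfl⟩; simp; ring,
    pow_mul, exp_two_pi_I_div_pow, one_pow, one_mul]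

/-- `ℂ^× ∖ 16^{-1/N} μ_N` is open. [folklore] -/
theorem isOpen_setOf_ne_zero_and_pow_ne (N : ℕ) : IsOpen {u : ℂ | u ≠ 0 ∧ 16 * u ^ N ≠ 1} :=
  (isOpen_ne_fun continuous_id continuous_const).inter
    (isOpen_ne_fun (continuous_const.mul (continuous_pow N)) continuous_const)

/-- **`x = (λ/16)^{1/N} : ℍ → ℂ^× ∖ 16^{-1/N}μ_N` is the quotient covering map of the free, properly
discontinuous action of its deck group `Λ_N`.**
[cite: CalegariDimitrovTang2025, §3, proof of Proposition 15] -/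
theorem isQuotientCoveringMap_modularLambdaRoot {N : ℕ} (hN : N ≠ 0) :
    IsQuotientCoveringMap
      (fun τ : ℍ ↦ (⟨modularLambdaRoot N τ, modularLambdaRoot_ne_zero N τ,
        sixteen_mul_modularLambdaRoot_pow_ne_one hN τ⟩ : {u : ℂ | u ≠ 0 ∧ 16 * u ^ N ≠ 1}))
      (modularLambdaRootDeck N) := by
  haveI : ContinuousConstSMul (modularLambdaRootDeck N) ℍ :=
    ⟨fun γ ↦ continuous_const_smul
      ((Matrix.SpecialLinearGroup.mapGL ℝ ((γ : SL(2, ℤ))) : GL (Fin 2) ℝ))⟩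
  haveI := properlyDiscontinuousSMul_subgroup (modularLambdaRootDeck N)
  haveI := isCancelSMul_modularLambdaRootDeck N
  refine Topology.IsQuotientMap.isQuotientCoveringMap_of_properlyDiscontinuousSMul ?_ ?_
  · refine IsOpenMap.isQuotientMap ?_ ?_ ?_
    · exact (IsOpen.isOpenEmbedding_subtypeVal (isOpen_setOf_ne_zero_and_pow_ne N)).isOpenMap_iff.mpr
        (isOpenMap_modularLambdaRoot hN)
    · exact (continuous_modularLambdaRoot N).subtype_mk _
    · rintro ⟨u, hu₀, hu₁⟩
      obtain ⟨τ, hτ⟩ := exists_modularLambdaRoot_eq hN hu₀ hu₁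
      exact ⟨τ, Subtype.ext hτ⟩
  · intro e₁ e₂
    rw [Subtype.ext_iff]
    exact modularLambdaRoot_eq_iff_mem_orbit hN

/-- **`x = (λ/16)^{1/N} : ℍ → ℂ^× ∖ 16^{-1/N}μ_N` is a covering map.**
[cite: CalegariDimitrovTang2025, §3, proof of Proposition 15] -/
theorem isCoveringMap_modularLambdaRoot {N : ℕ} (hN : N ≠ 0) :
    IsCoveringMap (fun τ : ℍ ↦ (⟨modularLambdaRoot N τ, modularLambdaRoot_ne_zero N τ,
      sixteen_mul_modularLambdaRoot_pow_ne_one hN τ⟩ : {u : ℂ | u ≠ 0 ∧ 16 * u ^ N ≠ 1})) :=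
  (isQuotientCoveringMap_modularLambdaRoot hN).isCoveringMap _ _

/-- `x = (λ/16)^{1/N}` is a covering map over `ℂ^× ∖ 16^{-1/N}μ_N`.
[cite: CalegariDimitrovTang2025, §3, proof of Proposition 15] -/
theorem isCoveringMapOn_modularLambdaRoot {N : ℕ} (hN : N ≠ 0) :
    IsCoveringMapOn (modularLambdaRoot N) {u : ℂ | u ≠ 0 ∧ 16 * u ^ N ≠ 1} :=
  .of_isCoveringMap_subtype (isOpen_setOf_ne_zero_and_pow_ne N) _ (isCoveringMap_modularLambdaRoot hN)

/-- `x = (λ/16)^{1/N}` is a local homeomorphism `ℍ → ℂ`. [folklore] -/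
theorem isLocalHomeomorph_modularLambdaRoot {N : ℕ} (hN : N ≠ 0) :
    IsLocalHomeomorph (modularLambdaRoot N) :=
  ((isOpen_setOf_ne_zero_and_pow_ne N).isOpenEmbedding_subtypeVal.isLocalHomeomorph).comp
    (isCoveringMap_modularLambdaRoot hN).isLocalHomeomorph

/-- **Lifting through `x = (λ/16)^{1/N}`**: continuous maps from simply connected, locally
path-connected spaces to `ℂ^× ∖ 16^{-1/N}μ_N` lift uniquely through `x` once a base point is
prescribed. [folklore] -/
theorem exists_unique_lift_modularLambdaRoot {N : ℕ} (hN : N ≠ 0) {A : Type*} [TopologicalSpace A]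
    [SimplyConnectedSpace A] [LocallyPathConnectedSpace A] {f : A → ℂ} (hf : Continuous f)
    (hf₀ : ∀ a, f a ≠ 0) (hf₁ : ∀ a, 16 * f a ^ N ≠ 1) (a₀ : A) (τ₀ : ℍ)
    (h₀ : modularLambdaRoot N τ₀ = f a₀) :
    ∃! F : C(A, ℍ), F a₀ = τ₀ ∧ ∀ a, modularLambdaRoot N (F a) = f a := by
  set f' : C(A, {u : ℂ | u ≠ 0 ∧ 16 * u ^ N ≠ 1}) :=
    ⟨fun a ↦ ⟨f a, hf₀ a, hf₁ a⟩, hf.subtype_mk _⟩ with hf'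
  obtain ⟨F, ⟨hF₀, hF⟩, huniq⟩ :=
    (isCoveringMap_modularLambdaRoot hN).existsUnique_continuousMap_lifts f' a₀ τ₀ (Subtype.ext h₀)
  refine ⟨F, ⟨hF₀, fun a ↦ ?_⟩, fun G ⟨hG₀, hG⟩ ↦ huniq G ⟨hG₀, ?_⟩⟩
  · have hfa : ((f' a : {u : ℂ | u ≠ 0 ∧ 16 * u ^ N ≠ 1}) : ℂ) = f a := rfl
    rw [← hfa]
    exact congrArg Subtype.val (congrFun hF a)
  · funext a
    exact Subtype.ext (hG a)

/-! ## The rescaled uniformizer `16^{1/N} x : ℍ → ℂ ∖ μ_N` (appended) -/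

/-- **`(16^{1/N} · x)ᴺ = λ`**: the rescaled uniformizer `x̂ = 16^{1/N} x` is an `N`-th root of `λ`
itself, so that `x̂` takes values in `ℂ^× ∖ μ_N`, the target of the universal covering `F_N` of
Calegari–Dimitrov–Tang §5 (`φ = 16^{-1/N} F_N(r·)` has `φᴺ` comparable with `λ/16 = xᴺ`).
[cite: CalegariDimitrovTang2025, §3, proof of Proposition 15] -/
theorem rpow_mul_modularLambdaRoot_pow {N : ℕ} (hN : N ≠ 0) (τ : ℍ) :
    ((((16 : ℝ) ^ ((N : ℝ)⁻¹) : ℝ) : ℂ) * modularLambdaRoot N τ) ^ N = modularLambda (τ : ℂ) := by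
  have hN0 : (N : ℝ) ≠ 0 := by exact_mod_cast hN
  have hrN : ((16 : ℝ) ^ ((N : ℝ)⁻¹)) ^ N = 16 := by
    rw [← Real.rpow_natCast, ← Real.rpow_mul (by norm_num), inv_mul_cancel₀ hN0, Real.rpow_one]
  have hcN : ((((16 : ℝ) ^ ((N : ℝ)⁻¹) : ℝ) : ℂ)) ^ N = 16 := by exact_mod_cast hrN
  rw [mul_pow, hcN, modularLambdaRoot_pow hN]
  ring

/-- **`(16^{1/N} · x)ᴺ ≠ 1`**: `x̂ = 16^{1/N} x` maps `ℍ` into `ℂ ∖ μ_N` (`λ ≠ 1` on `ℍ`).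
[cite: CalegariDimitrovTang2025, §3, proof of Proposition 15] -/
theorem rpow_mul_modularLambdaRoot_pow_ne_one {N : ℕ} (hN : N ≠ 0) (τ : ℍ) :
    ((((16 : ℝ) ^ ((N : ℝ)⁻¹) : ℝ) : ℂ) * modularLambdaRoot N τ) ^ N ≠ 1 := by
  rw [rpow_mul_modularLambdaRoot_pow hN]
  exact modularLambda_ne_one τ.im_pos


end ModularLambda

end Literature.NumberTheory.Automorphic

end
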